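import Summits.ResolutionOfSingularities.ResolutionOfSingularities.Theorems.PurelyInseparableDim4ResConeKTwoFiveTailDOnly
import Summits.ResolutionOfSingularities.ResolutionOfSingularities.Theorems.PurelyInseparableDim4ResConeDInfTail
import Summits.ResolutionOfSingularities.ResolutionOfSingularities.Theorems.PurelyInseparableDim4NarrowDrop
import HarnessLib
import HarnessLib.Audit.Tags

/-!
# Purely inseparable four-folds — **K2(5) ‖ KERNEL**: `RidgeBudget.NoAboveFloorTrap 5 5` — there is NO infinite chain of point blow-ups of
# ISOLATED 5-fold points of `z⁵ + F(x₁,…,x₄) = 0` staying above the floor (no state of order exactly `5`) — and hence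
# **F4-I(5,5) ⟸ CJS Key Theorem 6.40 alone** (cell `res-dim4-pi`, D-0157 DOOR 2, the K2(p) lane's CLOSING THEOREM at p = 5; holder file)

[OURS · counted 0 · cell `res-dim4-pi` · K2(p) lane holder res-dim4-p-12 g4; the theorem is the COMPOSITION BY NAME of the lane's bricks —
res-dim4-p-1/p-2/p-3/p-5/p-7/p-9/p-11/typ-1 (all generations), res-dim4-idea-1 (CARD I-1-8 / I-1-9 / I-1-10: the Φ = β_h lines), res-dim4-idea-4
(class automaton, E2-WINDOW, (PC)), critics res-dim4-crit-4 (K lane) / crit-2, desk res-dim4-desk.]  **HONEST LABEL.**  This is a theorem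
about OUR MODEL: the coordinate point-blow-up walk `CentreBlowup.step` with cleaning on presented states `(F, r, exc)` of the class
`z^p + F(x₁..x₄)` at `p = 5`, and its ISOLATED regime (`IsIsolated`: the 5-fold locus of `z⁵ + F` is the point).  It does NOT prove
resolution of singularities in dimension ≥ 4 / characteristic `p`, nor F4-I(5,5) (`NoIsolatedTrap 5 5`, which needs in addition the wide
floor regime = the published CJS Key Theorem 6.40 as typed, `KeyTheorem640_char_localized_isolated`, unproved in the tree), nor anything about
non-isolated points, other characteristics or Hironaka's statement.  AI kernel work, weaker than expert review.

* **`noAboveFloorTrap_five : RidgeBudget.NoAboveFloorTrap 5 5`** := the socket `noAboveFloorTrap_five_iff_tails` (p704409: slice B closed by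
  `twoSlot_slotT_residual` p701277 and `SwapTransport.cInf_rotation_residual` p703636) fed with the two slice-C tails:
  TAIL-B `(5,3)` = res-dim4-p-9 g4's `ResCone.tailB_three_five` (p706443; B∞ by the Φ = β_h line: entry p702794, keep p704534 (p-7), lose (p-2),
  potential assembly p702997/p703425; light class by res-dim4-p-1 g5's `LightRep.light_lossfree_representation` p705856 ∘ C13), and
  TAIL-D `(5,4)` = res-dim4-p-7 g5's `ResCone.tailD_four_five` (p707872; D∞ by the heavy β-line: abstract p706494, assembly p707409, E₄ p707534
  (p-9), K₄ p707218, L₄ p707423 (p-2), over p-11's laws; light pair by res-dim4-p-3 g4's `no_light_pair_tail_four_five` with res-dim4-p-5's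
  TT persistence p705581).
* **`noIsolatedTrap_five_of_KeyTheorem640 (hK640) : NoIsolatedTrap 5 5`** — F4-I(5,5) from the NAMED PUBLISHED FACT CJS Thm 6.40 alone
  (`E2OfCJS.noIsolatedTrap_of_KeyTheorem640_of_noAboveFloorTrap`: NarrowDrop p662631 + NoWideTrap ⟸ 6.40, res-dim4-p-1 g2 / res-dim4-p-11).
* `noIsolatedTrap_five_iff_noWideTrap_five` — equivalently, F4-I(5,5) is now EXACTLY the wide-floor statement `NoWideTrap 5 5`.

[cite: CossartJannsenSaito2020, Thm. 3.14, Thm. 6.40, Lemma 13.4, Thm. 13.7] [cite: HauserPerlega2019PRIMS, §2 (transform D′ of D)]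
[cite: Hauser2010, §§F–G] bears_on: LADDER-RESOLUTION:D157-DOOR2 (res-dim4-pi · K2(5) ‖ K).  Supports stmt-ResolutionOfSingularities-16155 (helper).
-/

set_option linter.dupNamespace false -- mandated namespace of this single-conjunct summit

noncomputable section

namespace Summit.ResolutionOfSingularities.ResolutionOfSingularities.Theorems.PIDim4

namespace ResCone

open MvPolynomial Finset
open Literature.AlgebraicGeometry.Resolution
open Literature.AlgebraicGeometry.Resolution.CentreBlowup
open Literature.AlgebraicGeometry.Resolution.Hauser2010
open Literature.AlgebraicGeometry.Resolution.HauserPerlega2019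
open RidgeBudget (NoAboveFloorTrap NoWideTrap)
open Literature.AlgebraicGeometry.CossartJannsenSaito2020 (KeyTheorem640_char_localized_isolated)

/-- **K2(5) ‖ KERNEL.**  `RidgeBudget.NoAboveFloorTrap 5 5`: over every field of characteristic `5` there is no infinite `Step0 5` chain
(point blow-ups with cleaning, in OUR coordinate frame) of ISOLATED 5-fold points of `z⁵ + F(x₁,…,x₄)` none of whose states has order
exactly `5`.  Composition of the socket `noAboveFloorTrap_five_iff_tailD` (v8.3: slice B closed, TAIL-B `(5,3)` closed by
`no_binaryCone_tail_three_five` ≡ res-dim4-p-9 g4's `tailB_three_five`) with `tailD_four_five` (res-dim4-p-7 g5).  A statement about our model, not about resolution of singularities. [OURS] [cite: CossartJannsenSaito2020, Thm. 3.14, Thm. 13.7] -/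
theorem noAboveFloorTrap_five : NoAboveFloorTrap 5 5 :=
  noAboveFloorTrap_five_iff_tailD.mpr tailD_four_five

/-- **F4-I(5,5) FROM CJS 6.40 ALONE.**  `NoIsolatedTrap 5 5` — no infinite point-blow-up chain of ISOLATED 5-fold points of
`z⁵ + F(x₁,…,x₄)` in our frame — follows from the published Key Theorem 6.40 of Cossart–Jannsen–Saito as typed in the tree
(`KeyTheorem640_char_localized_isolated`, feeding the wide floor regime `NoWideTrap 5 5`), by the ridge trichotomy: NarrowDrop (p662631) ·
NoWideTrap ⟸ 6.40 · NoAboveFloorTrap = `noAboveFloorTrap_five`. [OURS · conditional on a NAMED PUBLISHED FACT]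
[cite: CossartJannsenSaito2020, Thm. 6.40, Thm. 3.14] -/
theorem noIsolatedTrap_five_of_KeyTheorem640 (hK640 : KeyTheorem640_char_localized_isolated.{0}) : NoIsolatedTrap 5 5 :=
  haveI : Fact (Nat.Prime 5) := ⟨by norm_num⟩
  E2OfCJS.noIsolatedTrap_of_KeyTheorem640_of_noAboveFloorTrap 5 (by norm_num) hK640 noAboveFloorTrap_five

/-- **F4-I(5,5) IS NOW EXACTLY THE WIDE FLOOR REGIME**: `NoIsolatedTrap 5 5 ↔ NoWideTrap 5 5` (the narrow floor regime drops by
`RidgeBudget.narrowDrop`, the above-floor regime by `noAboveFloorTrap_five`). [OURS] [cite: CossartJannsenSaito2020, Thm. 3.14] -/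
theorem noIsolatedTrap_five_iff_noWideTrap_five : NoIsolatedTrap 5 5 ↔ NoWideTrap 5 5 :=
  haveI : Fact (Nat.Prime 5) := ⟨by norm_num⟩
  ⟨RidgeBudget.noWideTrap_of_noIsolatedTrap 5 5,
    fun hW => RidgeBudget.noIsolatedTrap_of_trichotomy 5 (RidgeBudget.narrowDrop 5) hW noAboveFloorTrap_five⟩

end ResCone

end Summit.ResolutionOfSingularities.ResolutionOfSingularities.Theorems.PIDim4

end
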